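import Summits.SmoothPoincare4.SmoothPoincare4.Theorems.SymplecticOrigamiOrigamiFoldExistenceHelperArchimedesMap
import Literature.Geometry.Symplectic.SphereProdSymplecticHost
import Literature.Geometry.Symplectic.StandardEnd

/-!
# Helper `helper_darbouxBall_sphereProdFour` of line `stable-seam-host` for crux
`OrigamiFoldExistence` (item stmt-SmoothPoincare4-7844; lead c10, wave 1)

Second brick of `helper_stableSeamHypotheses_inhabited`: **a symplectic embedding of the Darboux
ball `B⁴(2) ⊂ (ℝ⁴, ω₀)` into the host `(S² × S², σ ⊕ σ)` charted on `ℝ⁴`**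
(`Literature.Geometry.Symplectic.SphereProdFour`, `sphereProdFourForm`): the product
`z ↦ (F(z₀, z₁), F(z₂, z₃))` of two Archimedes charts (`helper_archimedesMap`, p155661) followed by
the identity diffeomorphism `sphereProdFourDiffeo⁻¹ : S² × S² ≅ SphereProdFour`.  On the ball of
radius `2` it is `C^∞`, injective, has bijective differential, and pulls `σ ⊕ σ` back to
`ω₀ = dx₀ ∧ dx₁ + dx₂ ∧ dx₃` (`Literature.Geometry.Symplectic.stdSymplecticForm`) EXACTLY
(McDuff–Salamon 2017, §3.1 p. 106: products of symplectomorphisms; Ex. 3.1.2).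

Def-free (existence statements; the coordinate projections `ℝ⁴ → ℝ²` and the maps enter the
private lemmas as variables with defining equations).
-/

noncomputable section

-- the prescribed namespace `Summit.<P>.<Sub>.…` duplicates `SmoothPoincare4` (P = Sub)
set_option linter.dupNamespace false

open scoped Manifold ContDiff Topology RealInnerProductSpace
open Set Function Metric
open Literature.Geometry.Symplectic Literature.Geometry.Kaehler

namespace Summit.SmoothPoincare4.SmoothPoincare4.Theorems.OrigamiFoldExistence.StableSeamHost

/-! ### The coordinate projections `ℝ⁴ → ℝ² × ℝ²` -/

/-- The two coordinate projections `(z₀, z₁)` and `(z₂, z₃)` of `ℝ⁴` as continuous linear maps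
(stated as an existence so that no definition is added). [folklore] -/
private theorem exists_coordPairs :
    ∃ p q : EuclideanSpace ℝ (Fin 4) →L[ℝ] EuclideanSpace ℝ (Fin 2), ∀ z : EuclideanSpace ℝ (Fin 4),
      p z 0 = z 0 ∧ p z 1 = z 1 ∧ q z 0 = z 2 ∧ q z 1 = z 3 := by
  refine ⟨LinearMap.toContinuousLinearMap
      { toFun := fun z => WithLp.toLp 2 ![z 0, z 1]
        map_add' := fun z z' => by ext i; fin_cases i <;> simp
        map_smul' := fun c z => by ext i; fin_cases i <;> simp },
    LinearMap.toContinuousLinearMap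
      { toFun := fun z => WithLp.toLp 2 ![z 2, z 3]
        map_add' := fun z z' => by ext i; fin_cases i <;> simp
        map_smul' := fun c z => by ext i; fin_cases i <;> simp }, fun z => ?_⟩
  simp

/-- `‖z‖² = Σ zᵢ²` on `ℝ⁴`. [folklore] -/
private theorem norm_sq_four (z : EuclideanSpace ℝ (Fin 4)) :
    ‖z‖ ^ 2 = z 0 ^ 2 + z 1 ^ 2 + z 2 ^ 2 + z 3 ^ 2 := by
  rw [EuclideanSpace.real_norm_sq_eq, Fin.sum_univ_four]

/-- `‖w‖² = w₀² + w₁²` on `ℝ²`. [folklore] -/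
private theorem norm_sq_two' (w : EuclideanSpace ℝ (Fin 2)) : ‖w‖ ^ 2 = w 0 ^ 2 + w 1 ^ 2 := by
  rw [EuclideanSpace.real_norm_sq_eq, Fin.sum_univ_two]

section Product

variable {p q : EuclideanSpace ℝ (Fin 4) →L[ℝ] EuclideanSpace ℝ (Fin 2)}
  (hpq : ∀ z : EuclideanSpace ℝ (Fin 4), p z 0 = z 0 ∧ p z 1 = z 1 ∧ q z 0 = z 2 ∧ q z 1 = z 3)

include hpq in
/-- The coordinate projections map the ball of radius `2` of `ℝ⁴` into the disc of radius `2`.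
[folklore] -/
private theorem coordPairs_mem_ball {z : EuclideanSpace ℝ (Fin 4)} (hz : z ∈ ball (0 : _) 2) :
    p z ∈ ball (0 : EuclideanSpace ℝ (Fin 2)) 2 ∧ q z ∈ ball (0 : EuclideanSpace ℝ (Fin 2)) 2 := by
  obtain ⟨h0, h1, h2, h3⟩ := hpq z
  rw [mem_ball_zero_iff] at hz ⊢
  rw [mem_ball_zero_iff]
  have hz4 := norm_sq_four z
  have hp2 : ‖p z‖ ^ 2 ≤ ‖z‖ ^ 2 := by
    rw [norm_sq_two', h0, h1, hz4]; nlinarith [sq_nonneg (z 2), sq_nonneg (z 3)]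
  have hq2 : ‖q z‖ ^ 2 ≤ ‖z‖ ^ 2 := by
    rw [norm_sq_two', h2, h3, hz4]; nlinarith [sq_nonneg (z 0), sq_nonneg (z 1)]
  have hzn := norm_nonneg z
  constructor
  · nlinarith [norm_nonneg (p z)]
  · nlinarith [norm_nonneg (q z)]

include hpq in
/-- A vector of `ℝ⁴` with both coordinate pairs zero is zero. [folklore] -/
private theorem eq_zero_of_coordPairs {v : EuclideanSpace ℝ (Fin 4)} (hp : p v = 0) (hq : q v = 0) :
    v = 0 := by
  obtain ⟨h0, h1, h2, h3⟩ := hpq v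
  rw [hp] at h0 h1
  rw [hq] at h2 h3
  ext i
  fin_cases i
  · simpa using h0.symm
  · simpa using h1.symm
  · simpa using h2.symm
  · simpa using h3.symm

variable {F : EuclideanSpace ℝ (Fin 2) → Metric.sphere (0 : EuclideanSpace ℝ (Fin 3)) 1}
  (hFs : ContMDiffOn (𝓡 2) (𝓡 2) ∞ F (ball 0 2)) (hFi : InjOn F (ball 0 2))
  (hFd : ∀ z ∈ ball (0 : EuclideanSpace ℝ (Fin 2)) 2, Injective (mfderiv (𝓡 2) (𝓡 2) F z))
  (hFσ : ∀ z ∈ ball (0 : EuclideanSpace ℝ (Fin 2)) 2, ∀ a b : EuclideanSpace ℝ (Fin 2),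
    sphereAreaForm (F z) ![mfderiv (𝓡 2) (𝓡 2) F z a, mfderiv (𝓡 2) (𝓡 2) F z b] =
      a 0 * b 1 - a 1 * b 0)

include hpq hFs in
/-- The product chart `z ↦ (F(z₀,z₁), F(z₂,z₃))` is `C^∞` on the ball of radius `2`. [folklore] -/
private theorem contMDiffOn_prodChart :
    ContMDiffOn (𝓡 4) ((𝓡 2).prod (𝓡 2)) ∞ (fun z => (F (p z), F (q z))) (ball 0 2) := by
  have hp : ContMDiffOn (𝓡 4) (𝓡 2) ∞ (fun z => F (p z)) (ball 0 2) :=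
    hFs.comp p.contMDiff.contMDiffOn fun z hz => (coordPairs_mem_ball hpq hz).1
  have hq : ContMDiffOn (𝓡 4) (𝓡 2) ∞ (fun z => F (q z)) (ball 0 2) :=
    hFs.comp q.contMDiff.contMDiffOn fun z hz => (coordPairs_mem_ball hpq hz).2
  exact hp.prodMk hq

include hpq hFi in
/-- The product chart is injective on the ball of radius `2`. [folklore] -/
private theorem injOn_prodChart : InjOn (fun z => (F (p z), F (q z))) (ball 0 2) := by
  intro z hz z' hz' h
  obtain ⟨h1, h2⟩ := Prod.mk.inj h
  have ep : p z = p z' := hFi (coordPairs_mem_ball hpq hz).1 (coordPairs_mem_ball hpq hz').1 h1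
  have eq' : q z = q z' := hFi (coordPairs_mem_ball hpq hz).2 (coordPairs_mem_ball hpq hz').2 h2
  have : z - z' = 0 := eq_zero_of_coordPairs hpq (by rw [map_sub, ep, sub_self])
    (by rw [map_sub, eq', sub_self])
  exact sub_eq_zero.1 this

include hpq hFs in
/-- The differential of the product chart: `d(F ∘ p, F ∘ q)_z v = (dF_{pz} (p v), dF_{qz} (q v))`.
[folklore] -/
private theorem hasMFDerivAt_prodChart {z : EuclideanSpace ℝ (Fin 4)} (hz : z ∈ ball (0 : _) 2) :
    HasMFDerivAt (𝓡 4) ((𝓡 2).prod (𝓡 2)) (fun z => (F (p z), F (q z))) z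
      (((mfderiv (𝓡 2) (𝓡 2) F (p z)).comp p).prod ((mfderiv (𝓡 2) (𝓡 2) F (q z)).comp q)) := by
  obtain ⟨hpz, hqz⟩ := coordPairs_mem_ball hpq hz
  have hFp : HasMFDerivAt (𝓡 2) (𝓡 2) F (p z) (mfderiv (𝓡 2) (𝓡 2) F (p z)) :=
    ((hFs.contMDiffAt (isOpen_ball.mem_nhds hpz)).mdifferentiableAt (by simp)).hasMFDerivAt
  have hFq : HasMFDerivAt (𝓡 2) (𝓡 2) F (q z) (mfderiv (𝓡 2) (𝓡 2) F (q z)) :=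
    ((hFs.contMDiffAt (isOpen_ball.mem_nhds hqz)).mdifferentiableAt (by simp)).hasMFDerivAt
  have h1 : HasMFDerivAt (𝓡 4) (𝓡 2) (fun z => F (p z)) z ((mfderiv (𝓡 2) (𝓡 2) F (p z)).comp p) :=
    hFp.comp z p.hasMFDerivAt
  have h2 : HasMFDerivAt (𝓡 4) (𝓡 2) (fun z => F (q z)) z ((mfderiv (𝓡 2) (𝓡 2) F (q z)).comp q) :=
    hFq.comp z q.hasMFDerivAt
  exact h1.prodMk h2

include hpq hFs hFd in
/-- The differential of the product chart is bijective on the ball (injective by the injectivity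
of `dF` in each factor, then a dimension count `4 = 2 + 2`). [folklore] -/
private theorem bijective_mfderiv_prodChart {z : EuclideanSpace ℝ (Fin 4)}
    (hz : z ∈ ball (0 : _) 2) :
    Bijective (mfderiv (𝓡 4) ((𝓡 2).prod (𝓡 2)) (fun z => (F (p z), F (q z))) z) := by
  obtain ⟨hpz, hqz⟩ := coordPairs_mem_ball hpq hz
  rw [(hasMFDerivAt_prodChart hpq hFs hz).mfderiv]
  set L := ((mfderiv (𝓡 2) (𝓡 2) F (p z)).comp p).prod ((mfderiv (𝓡 2) (𝓡 2) F (q z)).comp q)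
    with hL
  have hinj : Injective L := by
    refine (injective_iff_map_eq_zero _).2 fun v hv => ?_
    have hv' := Prod.mk.inj hv
    have h1 : p v = 0 := (injective_iff_map_eq_zero _).1 (hFd _ hpz) _ hv'.1
    have h2 : q v = 0 := (injective_iff_map_eq_zero _).1 (hFd _ hqz) _ hv'.2
    exact eq_zero_of_coordPairs hpq h1 h2
  refine ⟨hinj, ?_⟩
  have hdim : Module.finrank ℝ (EuclideanSpace ℝ (Fin 4)) =
      Module.finrank ℝ (EuclideanSpace ℝ (Fin 2) × EuclideanSpace ℝ (Fin 2)) := by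
    simp [Module.finrank_prod]
  exact (LinearMap.injective_iff_surjective_of_finrank_eq_finrank (f := L.toLinearMap) hdim).1 hinj

include hpq hFs hFσ in
/-- **The product chart is symplectic**: `(σ ⊕ σ)(dG a, dG b) = ω₀(a, b)` on the ball of radius `2`
(McDuff–Salamon 2017, §3.1 p. 106). [folklore] -/
private theorem sphereProdForm_prodChart {z : EuclideanSpace ℝ (Fin 4)} (hz : z ∈ ball (0 : _) 2)
    (a b : EuclideanSpace ℝ (Fin 4)) :
    sphereProdForm (F (p z), F (q z))
      ![mfderiv (𝓡 4) ((𝓡 2).prod (𝓡 2)) (fun z => (F (p z), F (q z))) z a,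
        mfderiv (𝓡 4) ((𝓡 2).prod (𝓡 2)) (fun z => (F (p z), F (q z))) z b] =
      stdSymplecticForm a b := by
  obtain ⟨hpz, hqz⟩ := coordPairs_mem_ball hpq hz
  rw [(hasMFDerivAt_prodChart hpq hFs hz).mfderiv, sphereProdForm_apply]
  have e1 := hFσ _ hpz (p a) (p b)
  have e2 := hFσ _ hqz (q a) (q b)
  obtain ⟨ha0, ha1, ha2, ha3⟩ := hpq a
  obtain ⟨hb0, hb1, hb2, hb3⟩ := hpq b
  rw [ha0, ha1, hb0, hb1] at e1
  rw [ha2, ha3, hb2, hb3] at e2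
  change sphereAreaForm (F (p z)) ![mfderiv (𝓡 2) (𝓡 2) F (p z) (p a),
      mfderiv (𝓡 2) (𝓡 2) F (p z) (p b)] +
    sphereAreaForm (F (q z)) ![mfderiv (𝓡 2) (𝓡 2) F (q z) (q a),
      mfderiv (𝓡 2) (𝓡 2) F (q z) (q b)] = _
  rw [e1, e2, stdSymplecticForm]
  ring

end Product

/-! ### Transport to the `ℝ⁴`-charted host `SphereProdFour` -/

section Host

/-- Moving the base point of a `2`-form evaluated on two MODEL vectors (the tangent spaces of the
tree's `MForm`s are the model space definitionally). [folklore] -/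
private theorem mform_congr_point {E H M : Type*} [NormedAddCommGroup E] [NormedSpace ℝ E]
    [TopologicalSpace H] {I : ModelWithCorners ℝ E H} [TopologicalSpace M] [ChartedSpace H M]
    (β : MForm I M ℝ 2) {x y : M} (h : x = y) (v w : E) : β x ![v, w] = β y ![v, w] := by
  subst h
  rfl

variable {G₀ : EuclideanSpace ℝ (Fin 4) →
    (Metric.sphere (0 : EuclideanSpace ℝ (Fin 3)) 1) × (Metric.sphere (0 : EuclideanSpace ℝ (Fin 3)) 1)}
  (hG₀s : ContMDiffOn (𝓡 4) ((𝓡 2).prod (𝓡 2)) ∞ G₀ (ball 0 2)) (hG₀i : InjOn G₀ (ball 0 2))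
  (hG₀d : ∀ z ∈ ball (0 : EuclideanSpace ℝ (Fin 4)) 2,
    Bijective (mfderiv (𝓡 4) ((𝓡 2).prod (𝓡 2)) G₀ z))
  (hG₀σ : ∀ z ∈ ball (0 : EuclideanSpace ℝ (Fin 4)) 2, ∀ a b : EuclideanSpace ℝ (Fin 4),
    sphereProdForm (G₀ z) ![mfderiv (𝓡 4) ((𝓡 2).prod (𝓡 2)) G₀ z a,
      mfderiv (𝓡 4) ((𝓡 2).prod (𝓡 2)) G₀ z b] = stdSymplecticForm a b)

include hG₀s in
/-- The transported chart `Φ⁻¹ ∘ G₀` is `C^∞` on the ball. [folklore] -/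
private theorem contMDiffOn_hostChart :
    ContMDiffOn (𝓡 4) (𝓡 4) ∞ (fun z => sphereProdFourDiffeo.symm (G₀ z)) (ball 0 2) :=
  sphereProdFourDiffeo.symm.contMDiff.comp_contMDiffOn hG₀s

include hG₀i in
/-- The transported chart is injective on the ball. [folklore] -/
private theorem injOn_hostChart :
    InjOn (fun z => sphereProdFourDiffeo.symm (G₀ z)) (ball 0 2) :=
  fun _ hz _ hz' h => hG₀i hz hz' (sphereProdFourDiffeo.symm.injective h)

include hG₀s in
/-- Chain rule for the transported chart: `d(Φ⁻¹ ∘ G₀)_z = dΦ⁻¹ ∘ dG₀`. [folklore] -/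
private theorem mfderiv_hostChart {z : EuclideanSpace ℝ (Fin 4)} (hz : z ∈ ball (0 : _) 2) :
    mfderiv (𝓡 4) (𝓡 4) (fun z => sphereProdFourDiffeo.symm (G₀ z)) z =
      (mfderiv ((𝓡 2).prod (𝓡 2)) (𝓡 4) sphereProdFourDiffeo.symm (G₀ z)).comp
        (mfderiv (𝓡 4) ((𝓡 2).prod (𝓡 2)) G₀ z) :=
  mfderiv_comp z (sphereProdFourDiffeo.symm.mdifferentiable (by simp) _)
    ((hG₀s.contMDiffAt (isOpen_ball.mem_nhds hz)).mdifferentiableAt (by simp))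

include hG₀s hG₀d in
/-- The transported chart has bijective differential on the ball. [folklore] -/
private theorem bijective_mfderiv_hostChart {z : EuclideanSpace ℝ (Fin 4)}
    (hz : z ∈ ball (0 : _) 2) :
    Bijective (mfderiv (𝓡 4) (𝓡 4) (fun z => sphereProdFourDiffeo.symm (G₀ z)) z) := by
  rw [mfderiv_hostChart hG₀s hz]
  exact (bijective_mfderiv_diffeomorph sphereProdFourDiffeo.symm _).comp (hG₀d z hz)

include hG₀s hG₀σ in
/-- **The transported chart is symplectic for `σ ⊕ σ` on `SphereProdFour`**:
`(Φ^*(σ ⊕ σ))(d(Φ⁻¹ ∘ G₀) a, d(Φ⁻¹ ∘ G₀) b) = (σ ⊕ σ)(dG₀ a, dG₀ b) = ω₀(a, b)`. [folklore] -/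
private theorem sphereProdFourForm_hostChart {z : EuclideanSpace ℝ (Fin 4)}
    (hz : z ∈ ball (0 : _) 2) (a b : EuclideanSpace ℝ (Fin 4)) :
    sphereProdFourForm ((fun z => sphereProdFourDiffeo.symm (G₀ z)) z)
      ![mfderiv (𝓡 4) (𝓡 4) (fun z => sphereProdFourDiffeo.symm (G₀ z)) z a,
        mfderiv (𝓡 4) (𝓡 4) (fun z => sphereProdFourDiffeo.symm (G₀ z)) z b] = stdSymplecticForm a b := by
  set Φ := sphereProdFourDiffeo with hΦ
  have hG₀z : MDifferentiableAt (𝓡 4) ((𝓡 2).prod (𝓡 2)) G₀ z :=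
    (hG₀s.contMDiffAt (isOpen_ball.mem_nhds hz)).mdifferentiableAt (by simp)
  have hG'z : MDifferentiableAt (𝓡 4) (𝓡 4) (fun z => Φ.symm (G₀ z)) z :=
    (Φ.symm.mdifferentiable (by simp) _).comp z hG₀z
  have hfun : (⇑Φ ∘ fun z => Φ.symm (G₀ z)) = G₀ := funext fun y => Φ.apply_symm_apply _
  have hkey : (mfderiv (𝓡 4) ((𝓡 2).prod (𝓡 2)) Φ ((fun z => Φ.symm (G₀ z)) z)).comp
      (mfderiv (𝓡 4) (𝓡 4) (fun z => Φ.symm (G₀ z)) z) =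
      mfderiv (𝓡 4) ((𝓡 2).prod (𝓡 2)) G₀ z := by
    have h := mfderiv_comp z (Φ.mdifferentiable (by simp) _) hG'z
    rw [hfun] at h
    exact h.symm
  have hpt : Φ ((fun z => Φ.symm (G₀ z)) z) = G₀ z := Φ.apply_symm_apply _
  rw [show sphereProdFourForm = sphereProdForm.pullback (𝓡 4) ⇑Φ from rfl, MForm.pullback_apply]
  have hvec : (fun i => mfderiv (𝓡 4) ((𝓡 2).prod (𝓡 2)) Φ ((fun z => Φ.symm (G₀ z)) z)
      (![mfderiv (𝓡 4) (𝓡 4) (fun z => Φ.symm (G₀ z)) z a,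
        mfderiv (𝓡 4) (𝓡 4) (fun z => Φ.symm (G₀ z)) z b] i)) =
      ![mfderiv (𝓡 4) ((𝓡 2).prod (𝓡 2)) G₀ z a, mfderiv (𝓡 4) ((𝓡 2).prod (𝓡 2)) G₀ z b] := by
    funext i
    fin_cases i <;> exact DFunLike.congr_fun hkey _
  rw [hvec]
  exact (mform_congr_point sphereProdForm hpt _ _).trans (hG₀σ z hz a b)

end Host

/-! ### The registered helper -/

/-- **A symplectic embedding of the Darboux ball `B⁴(2) ⊂ (ℝ⁴, ω₀)` into the host
`(S² × S², σ ⊕ σ)` charted on `ℝ⁴`**: the product of two Archimedes equal-area charts followed by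
`sphereProdFourDiffeo⁻¹`; on the ball of radius `2` it is `C^∞`, injective, with bijective
differential, and pulls `sphereProdFourForm = σ ⊕ σ` back to `ω₀ = dx₀ ∧ dx₁ + dx₂ ∧ dx₃`
exactly (McDuff–Salamon 2017, §3.1 p. 106 and Ex. 3.1.2). [folklore] -/
theorem helper_darbouxBall_sphereProdFour :
    ∃ G : EuclideanSpace ℝ (Fin 4) → Literature.Geometry.Symplectic.SphereProdFour, ContMDiffOn (𝓡 4) (𝓡 4) ∞ G (Metric.ball 0 2) ∧ Set.InjOn G (Metric.ball 0 2) ∧ (∀ z ∈ Metric.ball (0 : EuclideanSpace ℝ (Fin 4)) 2, Function.Bijective (mfderiv (𝓡 4) (𝓡 4) G z)) ∧ ∀ z ∈ Metric.ball (0 : EuclideanSpace ℝ (Fin 4)) 2, ∀ a b : EuclideanSpace ℝ (Fin 4), Literature.Geometry.Symplectic.sphereProdFourForm (G z) ![mfderiv (𝓡 4) (𝓡 4) G z a, mfderiv (𝓡 4) (𝓡 4) G z b] = Literature.Geometry.Symplectic.stdSymplecticForm a b := by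
  obtain ⟨F, hFs, hFi, hFd, hFσ⟩ := helper_archimedesMap
  obtain ⟨p, q, hpq⟩ := exists_coordPairs
  have hG₀s := contMDiffOn_prodChart hpq hFs
  have hG₀i := injOn_prodChart hpq hFi
  have hG₀d : ∀ z ∈ ball (0 : EuclideanSpace ℝ (Fin 4)) 2,
      Bijective (mfderiv (𝓡 4) ((𝓡 2).prod (𝓡 2)) (fun z => (F (p z), F (q z))) z) :=
    fun z hz => bijective_mfderiv_prodChart hpq hFs hFd hz
  have hG₀σ : ∀ z ∈ ball (0 : EuclideanSpace ℝ (Fin 4)) 2, ∀ a b : EuclideanSpace ℝ (Fin 4),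
      sphereProdForm ((fun z => (F (p z), F (q z))) z)
        ![mfderiv (𝓡 4) ((𝓡 2).prod (𝓡 2)) (fun z => (F (p z), F (q z))) z a,
          mfderiv (𝓡 4) ((𝓡 2).prod (𝓡 2)) (fun z => (F (p z), F (q z))) z b] =
        stdSymplecticForm a b :=
    fun z hz a b => sphereProdForm_prodChart hpq hFs hFσ hz a b
  exact ⟨⇑sphereProdFourDiffeo.symm ∘ (fun z => (F (p z), F (q z))), contMDiffOn_hostChart hG₀s,
    injOn_hostChart hG₀i, fun z hz => bijective_mfderiv_hostChart hG₀s hG₀d hz,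
    fun z hz a b => sphereProdFourForm_hostChart hG₀s hG₀σ hz a b⟩

end Summit.SmoothPoincare4.SmoothPoincare4.Theorems.OrigamiFoldExistence.StableSeamHost

end
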